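import Summits.HubbardSuperconductivity.HubbardSuperconductivity.Theorems.AnisotropyChordInsertionEntropyTeleDeconfinement
import Summits.HubbardSuperconductivity.HubbardSuperconductivity.Theorems.AnisotropyChordStiffnessOperatorLink

/-!
# Route `AnisotropyChord` / H0 rotor rung: «CONDENSATE ≥ ρ(1−ρ)·e^{T/2}» FOR THE GROUND STATES THEMSELVES — the
# model-independent layer 1 of theory seat `hubbard-h0-rotor-theory-1`, cycle 9 (memo ROTOR-THEORY-9 §136 (e)–(g))
# instantiated on the Perron sector ground amplitudes of the XXZ / hard-core boson torus (unconditional part)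

Part S of the theory seat (tree: `…InsertionEntropyTeleTransfer/TeleDeconfinement`) proved, for ANY non-negative
sector amplitude whose support is closed under particle moves, `n₀/|V| ≥ ρ(1−ρ)·exp(T(ψ)/2)` with
`T(ψ) = meanTeleLog ψ N ≤ 0` the mean teleportation log-ratio.  This file discharges its side conditions for the
Perron sector ground amplitudes of `H(Δ) = xxzHamiltonian 1 (torusGraph 2 L) (−1) Δ`:

* `perronAmplitude_pos_of_weight_eq` — a Perron sector ground amplitude is strictly positive on EVERY configuration
  of its particle number (Perron–Frobenius on the connected sector, tree `Stiffness.perronAmplitude_pos_of_ne_zero`),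
  hence its support is closed under moves (`perronAmplitude_move_pos`) and its teleportation laws have symmetric
  supports (`perronAmplitude_teleLaw_symm`);
* `meanTeleLog_nonpos_of_isPerron` (`T(a) ≤ 0`);
* **`condensateDensity_ge_exp_meanTeleLog_of_isPerron`** — UNCONDITIONAL, every `L`, every `Δ`, every sector `M`:
  `ρ_L(1 − ρ_L)·exp(T(a)/2) ≤ condensateDensity a`, `ρ_L = 1/2 + M/L²`, for the Perron amplitude `a`;
* **`lambda_ge_exp_meanTeleLog_of_sectorGround`** — the same for every normalised sector ground state `ψ` in the
  route's order-parameter currency: `ρ_L(1−ρ_L)·exp(T(a)/2)·L⁴ ≤ Re⟨ψ, S⁺_tot S⁻_tot ψ⟩`.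

The Hamiltonian-level hypothesis `GroundStateTeleDeconfined` and its links to `EventualCondensate` are in the companion
file `…InsertionEntropyGroundStateDeconfinement`.  No physical hypothesis enters this file.
-/

set_option linter.dupNamespace false

noncomputable section

open Matrix Complex Finset Filter Topology
open Literature.MathematicalPhysics.QuantumLattice hiding torusPhase torusNorm
open Literature.Probability.LatticeModels

namespace Summit.HubbardSuperconductivity.HubbardSuperconductivity.Theorems.AnisotropyChord.InsertionEntropy

section PerronPositivity

variable {L : ℕ} [NeZero L]

/-- Removing the particle-hole bookkeeping: if `τ x = 1` then the weight of `update τ x 0` is one less than the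
weight of `τ`:  `W(update τ x 0) + 1 = W(τ)`. [folklore] -/
theorem weight_update_zero_add_one {V : Type} [Fintype V] [DecidableEq V] (τ : V → Fin 2) (x : V)
    (hx : τ x = 1) : (∑ z, (Function.update τ x 0 z : ℕ)) + 1 = ∑ z, (τ z : ℕ) := by
  have h1 : (∑ z, (Function.update τ x 0 z : ℕ))
      = (Function.update τ x 0 x : ℕ) + ∑ z ∈ univ.erase x, (Function.update τ x 0 z : ℕ) :=
    (Finset.add_sum_erase _ _ (Finset.mem_univ x)).symm
  have h2 : (∑ z, (τ z : ℕ)) = (τ x : ℕ) + ∑ z ∈ univ.erase x, (τ z : ℕ) :=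
    (Finset.add_sum_erase _ _ (Finset.mem_univ x)).symm
  have h3 : ∑ z ∈ univ.erase x, (Function.update τ x 0 z : ℕ) = ∑ z ∈ univ.erase x, (τ z : ℕ) :=
    Finset.sum_congr rfl fun z hz => by rw [Function.update_of_ne (Finset.ne_of_mem_erase hz)]
  rw [h1, h2, h3, Function.update_self, hx]
  simp only [Fin.isValue, Fin.val_zero, zero_add, Fin.val_one]
  ring

/-- Weights are invariant under relabelling by a permutation (in particular under a particle move
`σ ↦ σ ∘ swap u v`). [folklore] -/
theorem weight_comp_swap {V : Type} [Fintype V] [DecidableEq V] (σ : V → Fin 2) (u v : V) :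
    (∑ z, ((σ ∘ Equiv.swap u v) z : ℕ)) = ∑ z, (σ z : ℕ) :=
  Equiv.sum_comp (Equiv.swap u v) (fun z => (σ z : ℕ))

/-- **A Perron sector ground amplitude is strictly positive on every configuration of its weight class**: if
`a σ ≠ 0` and `τ` has the same weight (= number of holes, hence the same particle number) as `σ`, then `0 < a τ`.
Perron–Frobenius on the connected sector configuration graph (tree `Stiffness.perronAmplitude_pos_of_ne_zero`,
applied to the basis vector at `τ`, which lies in the sector by `LiebMattis.mem_spinZSector_weight_iff`).
Tasaki (2020) §2.4. [folklore] -/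
theorem perronAmplitude_pos_of_weight_eq (Δ M : ℝ) (a : TensorIndex (TorusSite 2 L) 2 → ℝ)
    (ha : IsPerronSectorGroundAmplitude L Δ M a) (σ τ : TensorIndex (TorusSite 2 L) 2) (hσ : a σ ≠ 0)
    (hw : (∑ z, (τ z : ℕ)) = ∑ z, (σ z : ℕ)) : 0 < a τ := by
  set ψ : TensorIndex (TorusSite 2 L) 2 → ℂ := fun s => (a s : ℂ) with hψ
  have hψ0 : ψ ≠ 0 := by
    intro h0
    have := congrFun h0 σ
    simp only [hψ, Pi.zero_apply, Complex.ofReal_eq_zero] at this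
    exact hσ this
  obtain ⟨W, -, hMW⟩ := exists_weight_of_mem_spinZSector ha.sector hψ0
  -- `σ` has weight `W`
  have hσW : (∑ z, (σ z : ℕ)) = W := by
    by_contra hne
    have hsec := ha.sector
    rw [hMW] at hsec
    have := (LiebMattis.mem_spinZSector_weight_iff 1 W ψ).1 hsec σ hne
    simp only [hψ, Complex.ofReal_eq_zero] at this
    exact hσ this
  -- the basis vector at `τ` is a sector vector that does not vanish at `τ`
  set φ : TensorIndex (TorusSite 2 L) 2 → ℂ := fun s => if s = τ then 1 else 0 with hφ
  have hφK : φ ∈ spinZSector (Λ := TorusSite 2 L) 1 M := by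
    rw [hMW]
    refine (LiebMattis.mem_spinZSector_weight_iff 1 W φ).2 fun s hs => ?_
    have hsτ : s ≠ τ := by
      rintro rfl
      exact hs (hw.trans hσW)
    simp [hφ, hsτ]
  have hφτ : φ τ ≠ 0 := by simp [hφ]
  exact Stiffness.perronAmplitude_pos_of_ne_zero Δ M a ha φ hφK τ hφτ

/-- **Support closed under particle moves:** `0 < a σ → 0 < a (σ ∘ swap u v)` for a Perron sector ground
amplitude (any `u, v`). [folklore] -/
theorem perronAmplitude_move_pos (Δ M : ℝ) (a : TensorIndex (TorusSite 2 L) 2 → ℝ)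
    (ha : IsPerronSectorGroundAmplitude L Δ M a) (σ : TensorIndex (TorusSite 2 L) 2) (u v : TorusSite 2 L)
    (hσ : 0 < a σ) : 0 < a (σ ∘ Equiv.swap u v) :=
  perronAmplitude_pos_of_weight_eq Δ M a ha σ _ hσ.ne' (weight_comp_swap σ u v)

/-- A single positive term bounds the pair mass from below: `τ x = τ y = 1`, `0 < a(update τ x 0)` ⇒
`0 < a_{xy}`. [folklore] -/
theorem pairMass_pos_of_term {V : Type} [Fintype V] [DecidableEq V] (a : (V → Fin 2) → ℝ) (x y : V)
    (τ : V → Fin 2) (hx : τ x = 1) (hy : τ y = 1) (hpos : 0 < a (Function.update τ x 0)) :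
    0 < pairMass a x y := by
  unfold pairMass
  have hle : (if τ x = 1 ∧ τ y = 1 then a (Function.update τ x 0) ^ 2 else 0)
      ≤ ∑ τ', (if τ' x = 1 ∧ τ' y = 1 then a (Function.update τ' x 0) ^ 2 else 0) :=
    Finset.single_le_sum (f := fun τ' => if τ' x = 1 ∧ τ' y = 1 then a (Function.update τ' x 0) ^ 2 else 0)
      (fun τ' _ => by split_ifs <;> positivity) (Finset.mem_univ τ)
  rw [if_pos ⟨hx, hy⟩] at hle
  exact lt_of_lt_of_le (by positivity) hle

/-- **Teleportation-support symmetry** for a Perron sector ground amplitude: `ν_x^{(y)}(τ) > 0 ⇒ ν_y^{(x)}(τ) > 0`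
(`x ≠ y`): both post-insertion configurations `update τ x 0`, `update τ y 0` have the same weight. [folklore] -/
theorem perronAmplitude_teleLaw_symm (Δ M : ℝ) (a : TensorIndex (TorusSite 2 L) 2 → ℝ)
    (ha : IsPerronSectorGroundAmplitude L Δ M a) (x y : TorusSite 2 L) (τ : TensorIndex (TorusSite 2 L) 2)
    (h : 0 < teleLaw a x y τ) : 0 < teleLaw a y x τ := by
  unfold teleLaw at h ⊢
  by_cases hxy : τ x = 1 ∧ τ y = 1
  · rw [if_pos hxy] at h
    rw [if_pos ⟨hxy.2, hxy.1⟩]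
    have hax : a (Function.update τ x 0) ≠ 0 := by
      intro h0
      rw [h0] at h
      simp at h
    have hwx := weight_update_zero_add_one τ x hxy.1
    have hwy := weight_update_zero_add_one τ y hxy.2
    have hay : 0 < a (Function.update τ y 0) :=
      perronAmplitude_pos_of_weight_eq Δ M a ha _ _ hax (by omega)
    exact div_pos (by positivity) (pairMass_pos_of_term a y x τ hxy.2 hxy.1 hay)
  · rw [if_neg hxy] at h
    exact absurd h (lt_irrefl 0)

end PerronPositivity

section GroundStates

/-- **`T(a) ≤ 0` for every Perron sector ground amplitude** of `H(Δ)` (sector `M`, `N = L²/2 + M` particles):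
the resampling identity + Jensen (tree `meanTeleLog_nonpos`), with the sector support and the move-closure supplied by
Perron–Frobenius. [folklore] -/
theorem meanTeleLog_nonpos_of_isPerron (L : ℕ) [NeZero L] (Δ M : ℝ) (a : TensorIndex (TorusSite 2 L) 2 → ℝ)
    (ha : IsPerronSectorGroundAmplitude L Δ M a) : meanTeleLog a ((L : ℝ) ^ 2 / 2 + M) ≤ 0 := by
  have hcard : (Fintype.card (TorusSite 2 L) : ℝ) = (L : ℝ) ^ 2 := by
    rw [Fintype.card_fun, ZMod.card, Fintype.card_fin]; push_cast; ring
  have hsect : ∀ σ, a σ ≠ 0 → ((univ.filter fun z => σ z = 0).card : ℝ) = (L : ℝ) ^ 2 / 2 + M := by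
    intro σ hσ
    rw [← hcard]
    exact card_filter_eq_zero_of_mem_sector ha.sector (by exact_mod_cast hσ : (a σ : ℂ) ≠ 0)
  exact meanTeleLog_nonpos a _ ha.nonneg ha.unit hsect
    (fun σ u v _ _ _ hσ => perronAmplitude_move_pos Δ M a ha σ u v hσ)

/-- **CONDENSATE ≥ ρ_L(1−ρ_L)·exp(T/2) FOR EVERY PERRON SECTOR GROUND AMPLITUDE (unconditional; every `L`, `Δ`,
`M`).**  With `ρ_L = 1/2 + M/L²` and `T = meanTeleLog a (L²/2 + M)` (the mean log-loss of a uniformly random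
one-particle teleportation in the ground state):  `ρ_L (1 − ρ_L) · exp(T/2) ≤ condensateDensity a`.
Uniform density (tree `siteDensity_eq_of_isPerron`), sector support, move-closure and teleportation-support symmetry
are all consequences of Perron–Frobenius + translation invariance, so NO hypothesis beyond «Perron sector ground
amplitude» remains. Theory seat memo ROTOR-THEORY-9 §136 (e)–(g). [folklore] -/
theorem condensateDensity_ge_exp_meanTeleLog_of_isPerron (L : ℕ) [NeZero L] (Δ M : ℝ)
    (a : TensorIndex (TorusSite 2 L) 2 → ℝ) (ha : IsPerronSectorGroundAmplitude L Δ M a) :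
    (1 / 2 + M / (L : ℝ) ^ 2) * (1 - (1 / 2 + M / (L : ℝ) ^ 2))
        * Real.exp (meanTeleLog a ((L : ℝ) ^ 2 / 2 + M) / 2)
      ≤ condensateDensity a := by
  have hL : (0 : ℝ) < (L : ℝ) := by exact_mod_cast Nat.pos_of_ne_zero (NeZero.ne L)
  have hcard : (Fintype.card (TorusSite 2 L) : ℝ) = (L : ℝ) ^ 2 := by
    rw [Fintype.card_fun, ZMod.card, Fintype.card_fin]; push_cast; ring
  set N : ℝ := (L : ℝ) ^ 2 / 2 + M with hNdef
  have hsect : ∀ σ, a σ ≠ 0 → ((univ.filter fun z => σ z = 0).card : ℝ) = N := by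
    intro σ hσ
    rw [hNdef, ← hcard]
    exact card_filter_eq_zero_of_mem_sector ha.sector (by exact_mod_cast hσ : (a σ : ℂ) ≠ 0)
  have main := condensateDensity_ge_exp_meanTeleLog a N ha.nonneg ha.unit hsect
    (pairMass_symm_of_siteDensity a _ (fun x => siteDensity_eq_of_isPerron L Δ M a ha x))
    (fun x y τ _ h => perronAmplitude_teleLaw_symm Δ M a ha x y τ h)
    (fun σ u v _ _ _ hσ => perronAmplitude_move_pos Δ M a ha σ u v hσ)
  have hρ : N / (Fintype.card (TorusSite 2 L) : ℝ) = 1 / 2 + M / (L : ℝ) ^ 2 := by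
    rw [hNdef, hcard]
    field_simp
  rw [hρ] at main
  exact main

/-- **Per-state form in the route's currency (unconditional):** for every `L`, `Δ`, `M` and every normalised
sector-`M` ground state `ψ` of `H(Δ)`, with `a` the sector's Perron amplitude,
`ρ_L(1−ρ_L)·exp(T(a)/2)·L⁴ ≤ Re⟨ψ, S⁺_tot S⁻_tot ψ⟩` (tree `Stiffness.lambda_eq_lowerNormSq_of_sectorGround`:
every normalised sector ground state carries the Perron state's order parameter). [folklore] -/
theorem lambda_ge_exp_meanTeleLog_of_sectorGround (L : ℕ) [NeZero L] (Δ M : ℝ)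
    (a : TensorIndex (TorusSite 2 L) 2 → ℝ) (ha : IsPerronSectorGroundAmplitude L Δ M a)
    (ψ : TensorIndex (TorusSite 2 L) 2 → ℂ) (hψK : ψ ∈ spinZSector (Λ := TorusSite 2 L) 1 M)
    (hψ1 : star ψ ⬝ᵥ ψ = 1)
    (hHψ : Stiffness.hcbHamiltonian L Δ *ᵥ ψ
      = ((lowestEnergyInSector 1 (Stiffness.hcbHamiltonian L Δ) M : ℝ) : ℂ) • ψ) :
    (1 / 2 + M / (L : ℝ) ^ 2) * (1 - (1 / 2 + M / (L : ℝ) ^ 2))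
        * Real.exp (meanTeleLog a ((L : ℝ) ^ 2 / 2 + M) / 2) * (L : ℝ) ^ 4
      ≤ (star ψ ⬝ᵥ (((∑ x : TorusSite 2 L, onSite x (spinRaise 1))
          * (∑ y : TorusSite 2 L, onSite y (spinLower 1)) : Op (TorusSite 2 L) 2) *ᵥ ψ)).re := by
  rw [Stiffness.lambda_eq_lowerNormSq_of_sectorGround Δ M a ha ψ hψK hψ1 hHψ]
  have hcd := condensateDensity_ge_exp_meanTeleLog_of_isPerron L Δ M a ha
  have hL0 : (0 : ℝ) < (L : ℝ) := by exact_mod_cast Nat.pos_of_ne_zero (NeZero.ne L)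
  unfold condensateDensity at hcd
  have hcard : (Fintype.card (TorusSite 2 L) : ℝ) = (L : ℝ) ^ 2 := by
    rw [Fintype.card_fun, ZMod.card, Fintype.card_fin]; push_cast; ring
  rw [hcard, le_div_iff₀ (by positivity)] at hcd
  calc (1 / 2 + M / (L : ℝ) ^ 2) * (1 - (1 / 2 + M / (L : ℝ) ^ 2))
          * Real.exp (meanTeleLog a ((L : ℝ) ^ 2 / 2 + M) / 2) * (L : ℝ) ^ 4
        = (1 / 2 + M / (L : ℝ) ^ 2) * (1 - (1 / 2 + M / (L : ℝ) ^ 2))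
          * Real.exp (meanTeleLog a ((L : ℝ) ^ 2 / 2 + M) / 2) * ((L : ℝ) ^ 2) ^ 2 := by ring
    _ ≤ lowerNormSq a := hcd

end GroundStates

end Summit.HubbardSuperconductivity.HubbardSuperconductivity.Theorems.AnisotropyChord.InsertionEntropy
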